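import Summits.NavierStokesRegularity.NavierStokesRegularity.Theorems.EfficiencyFloorProductionEfficiencyDecayLuDoeringRung
import Literature.Analysis.FluidPDE.LerayLocalRegularH1Proofs
import Literature.Analysis.FluidPDE.BKMClassGradientContinuity
import HarnessLib

/-!
# Route `EfficiencyFloor`, support `RigidExit` (stmt-NavierStokesRegularity-25513) on the `ProductionEfficiencyDecay`
# ladder (stmt-NavierStokesRegularity-22866): THE REFERENCE FLOW THROUGH AN ADMISSIBLE FIELD

Helper file (`--supports stmt-NavierStokesRegularity-22866`; line `efficiency_floor`). The landed typed residue of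
`RigidExit` (`…RigidExitOrbitwiseEarlyDeficit`, `…Converse`: `MaximiserSetRigidity → (RigidExit ⟺ hED)`) asks, for
each normalised Lu–Doering maximiser `m`, for a uniform early cubic-law deficit along flows passing near the orbit of
`m`. Its census (hands g20–g23) listed as missing «(ii-c) a REFERENCE FLOW through the exact maximiser — an
`H⁰∩H¹∩H²∩C^∞` divergence-free datum that is NOT rapidly decaying — with local strong existence on the closed window
fraction `[0, η·W]` and the sharp budget in ITS class; needs an `H²`-data local theory in the tree's classical
vocabulary». That local theory IS in the tree, for `H¹` data, PROVED:
`Literature.Analysis.FluidPDE.leray_local_regular_H1_holds` (Leray 1934 §§19–24 / Ożański–Pooley 2018 Thm. 6.30,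
Cor. 6.16 / Robinson–Rodrigo–Sadowski 2016 Thm. 6.15). This file draws the consequences for the route:

* §1 `memLp_two_of_admissible`, `isWeaklyDivFree_of_admissible`, `eWeakGradL2Sq_eq_lintegral_curl_sq`,
  `eWeakGradL2Sq_le_ofReal_enstrophy` — an ADMISSIBLE field (`C^∞`, `div m = 0`, `D⁰m, D¹m, D²m ∈ L²`) is an `H¹`
  divergence-free datum in the weak vocabulary of Leray's theorem, with weak dissipation `‖∇m‖²_{L²} = ∫|curl m|² = Z(m)`
  (div–curl identity `lintegral_frobeniusNormSq_fderiv_eq_lintegral_curl_sq`).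
* §2 `exists_referenceFlow` — there is an absolute `c_L > 0` such that every admissible `m` and every `ν, T > 0` with
  `Z(m)²·T ≤ c_L ν³` admit a REFERENCE FLOW `(v, q)`: Leray–Hopf on `[0,T]` from `m`, `v 0 = m`, `H¹`-continuous on
  `[0,T]`, classical on `(0,T]`, with all Sobolev norms of `v`, `∂ₜv`, `q` bounded on every `[δ,T]`.
* §3 `exists_referenceFlow_window` — WINDOW FORM: for every `c > 0` there is ONE `η₀ ∈ (0,1)` (uniform in `ν` and `m`)
  such that every admissible `m` with `Z(m) > 0` has a reference flow on the closed window fraction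
  `[0, η₀ · (64ν³/(27c⁴)) · Z(m)⁻²]` of the would-be blow-up time of the cubic law `Ż ≤ (27c⁴/(128ν³)) Z³`.
* §4 `referenceFlow_isLocalSolution_shift`, `referenceFlow_budget` — IN ITS CLASS the reference flow obeys the
  enstrophy budget at every interior time `t ∈ (0,T)`: the slice `v t` is admissible, the real enstrophy
  `Z(t) = ∫|curl v(t)|²` has derivative `2S − 2ν·Pal` (`S` the stretching, `Pal` the palinstrophy) and, for every
  one-sided admissible Lu–Doering constant `c`, `2S − 2ν·Pal ≤ (27c⁴/(128ν³))·Z³` (time shift into the Chae/BKM class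
  + the landed `LucardoOlivaes2026.hasDerivAt_half_ensq` + `LuDoeringRung.young_envelope`).

What remains of (ii-c) after this file: the enstrophy curve of the reference flow is continuous AT `t = 0⁺`
(`Z(v t) → Z(m)`, from `H¹`-continuity and `L²`-continuity of Leray–Hopf solutions at `0`) and instant exit of the
reference flow from the normalised-maximiser set (the item-(i) argument in the reference flow's class). HONEST FRAMING:
classical bookkeeping; `RigidExit`, `NearMaximiserBoundedAmplification`, `LerayFloorGap`, `ProductionEfficiencyDecay`
(stmt-22866) and Navier–Stokes regularity stay OPEN; no summit statement is proved. [folklore]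
-/

-- the problem directory repeats the summit name (`NavierStokesRegularity/NavierStokesRegularity`)
set_option linter.dupNamespace false

noncomputable section

open Set Filter MeasureTheory Topology Function
open scoped InnerProductSpace RealInnerProductSpace ENNReal NNReal ContDiff
open Literature.Analysis.FluidPDE

namespace Summit.NavierStokesRegularity.NavierStokesRegularity.Theorems

namespace RigidExit

namespace ReferenceFlow

open Literature.Claims.NS.Chae2007 (IsLocalSolution)
open Literature.Claims.NS.LucardoOlivaes2026 (ensq stretchI)
open Summit.NavierStokesRegularity.NavierStokesRegularity.Theorems.LucardoOlivaes2026 (hasDerivAt_half_ensq)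
open ProductionEfficiencyDecay.LuDoeringRung (young_envelope)

/-! ## §1 Admissible fields are `H¹` divergence-free data -/

variable {m : EuclideanSpace ℝ (Fin 3) → EuclideanSpace ℝ (Fin 3)}

/-- `∫⁻ ‖m‖ₑ² < ∞` from `∫⁻ ‖D⁰m‖ₑ² < ∞`. [folklore] -/
theorem lintegral_enorm_sq_lt_top_of_iteratedFDeriv_zero (h0 : ∫⁻ x, ‖iteratedFDeriv ℝ 0 m x‖ₑ ^ 2 < ⊤) :
    ∫⁻ x, ‖m x‖ₑ ^ 2 < ⊤ := by
  refine lt_of_le_of_lt (le_of_eq (lintegral_congr fun x => ?_)) h0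
  rw [← ofReal_norm, ← norm_iteratedFDeriv_zero (𝕜 := ℝ) (f := m), ofReal_norm]

/-- An admissible field is in `L²`. [folklore] -/
theorem memLp_two_of_admissible (hm : ContDiff ℝ (⊤ : ℕ∞) m) (h0 : ∫⁻ x, ‖iteratedFDeriv ℝ 0 m x‖ₑ ^ 2 < ⊤) :
    MemLp m 2 volume :=
  (memLp_two_iff_integrable_sq_norm hm.continuous.aestronglyMeasurable).2
    (integrable_sq_norm_of_lintegral_lt_top hm.continuous (lintegral_enorm_sq_lt_top_of_iteratedFDeriv_zero h0))

/-- An admissible field is weakly divergence free. [folklore] -/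
theorem isWeaklyDivFree_of_admissible (hm : ContDiff ℝ (⊤ : ℕ∞) m) (hdiv : VectorCalculus.IsDivFree m) :
    IsWeaklyDivFree m :=
  VectorCalculus.IsDivFree.isWeaklyDivFree_holds hdiv (hm.of_le (by norm_cast))

/-- The weak dissipation of an admissible field is its enstrophy: `‖∇m‖²_{L²} = ∫⁻ ‖curl m‖ₑ²`. [folklore] -/
theorem eWeakGradL2Sq_eq_lintegral_curl_sq (hm : ContDiff ℝ (⊤ : ℕ∞) m) (hdiv : VectorCalculus.IsDivFree m)
    (h0 : ∫⁻ x, ‖iteratedFDeriv ℝ 0 m x‖ₑ ^ 2 < ⊤) (h1 : ∫⁻ x, ‖iteratedFDeriv ℝ 1 m x‖ₑ ^ 2 < ⊤)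
    (h2 : ∫⁻ x, ‖iteratedFDeriv ℝ 2 m x‖ₑ ^ 2 < ⊤) :
    eWeakGradL2Sq m = ∫⁻ x, ‖curl m x‖ₑ ^ 2 := by
  rw [eWeakGradL2Sq_eq_of_hasWeakGradient (hasWeakGradient_fderiv_of_contDiff (hm.of_le (by norm_cast)))]
  exact lintegral_frobeniusNormSq_fderiv_eq_lintegral_curl_sq (hm.of_le (by norm_cast)) hdiv
    (lintegral_enorm_sq_lt_top_of_iteratedFDeriv_zero h0) h1 h2

/-- The weak dissipation of an admissible field as a real enstrophy: `‖∇m‖²_{L²} = ofReal (∫ ‖curl m‖²)`. [folklore] -/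
theorem eWeakGradL2Sq_eq_ofReal_enstrophy (hm : ContDiff ℝ (⊤ : ℕ∞) m) (hdiv : VectorCalculus.IsDivFree m)
    (h0 : ∫⁻ x, ‖iteratedFDeriv ℝ 0 m x‖ₑ ^ 2 < ⊤) (h1 : ∫⁻ x, ‖iteratedFDeriv ℝ 1 m x‖ₑ ^ 2 < ⊤)
    (h2 : ∫⁻ x, ‖iteratedFDeriv ℝ 2 m x‖ₑ ^ 2 < ⊤) :
    eWeakGradL2Sq m = ENNReal.ofReal (∫ x, ‖curl m x‖ ^ 2) := by
  rw [eWeakGradL2Sq_eq_lintegral_curl_sq hm hdiv h0 h1 h2]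
  exact lintegral_enorm_curl_sq_eq_ofReal_integral (hm.of_le (by norm_cast)) h1

/-! ## §2 Leray's reference flow through an admissible field -/

/-- **The reference flow.** There is an absolute `c_L > 0` such that for all `ν, T > 0` and every admissible field `m`
(`C^∞`, `div m = 0`, `D⁰m, D¹m, D²m ∈ L²`) with `(∫ ‖curl m‖²)² · T ≤ c_L ν³` there are `v, q` with: `v` Leray–Hopf on
`[0,T]` from `m`, `v 0 = m`, `‖v(t)‖²_{H¹}` finite and continuous on `[0,T]`, `(v,q)` classical on `(0,T]`, and on every
`[δ,T]`, `0 < δ ≤ T`, all Sobolev norms of `v` and `∂ₜv` bounded, all derivatives of `v` bounded, all Sobolev norms of `q`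
bounded (Leray 1934 §§19–24; the tree's proved `leray_local_regular_H1_holds`).
[cite: OzanskiPooley2018, Thm. 6.30, Cor. 6.16, Lemma 6.29] -/
theorem exists_referenceFlow :
    ∃ cL : ℝ, 0 < cL ∧ ∀ (ν T : ℝ), 0 < ν → 0 < T →
      ∀ m : EuclideanSpace ℝ (Fin 3) → EuclideanSpace ℝ (Fin 3),
        (ContDiff ℝ (⊤ : ℕ∞) m ∧ VectorCalculus.IsDivFree m ∧ (∫⁻ x, ‖iteratedFDeriv ℝ 0 m x‖ₑ ^ 2 < ⊤) ∧
          (∫⁻ x, ‖iteratedFDeriv ℝ 1 m x‖ₑ ^ 2 < ⊤) ∧ (∫⁻ x, ‖iteratedFDeriv ℝ 2 m x‖ₑ ^ 2 < ⊤)) →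
        (∫ x, ‖curl m x‖ ^ 2) ^ 2 * T ≤ cL * ν ^ 3 →
        ∃ (v : ℝ → EuclideanSpace ℝ (Fin 3) → EuclideanSpace ℝ (Fin 3)) (q : ℝ → EuclideanSpace ℝ (Fin 3) → ℝ),
          IsLerayHopfOn T ν 0 m v ∧ v 0 = m ∧ IsH1RegularOn (Icc 0 T) v ∧
          IsClassicalNSSolutionOn (Ioc 0 T) ν 0 v q ∧
          ∀ δ : ℝ, 0 < δ → δ ≤ T →
            HasBoundedSobolevNormsOn (Icc δ T) v ∧
            HasBoundedSobolevNormsOn (Icc δ T) (timeDerivWithin (Ioc 0 T) v) ∧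
            (∀ n : ℕ, ∃ C : ℝ, ∀ t ∈ Icc δ T, ∀ x, ‖iteratedFDeriv ℝ n (v t) x‖ ≤ C) ∧
            (∀ n : ℕ, ∃ C : ℝ≥0, ∀ t ∈ Icc δ T, ∫⁻ x, ‖iteratedFDeriv ℝ n (q t) x‖ₑ ^ 2 ≤ C) := by
  obtain ⟨cL, hcL, hloc⟩ := leray_local_regular_H1_holds
  refine ⟨cL, hcL, fun ν T hν hT m hm hT' => ?_⟩
  obtain ⟨hsm, hdiv, h0, h1, h2⟩ := hm
  have hA : 0 ≤ ∫ x, ‖curl m x‖ ^ 2 := integral_nonneg fun x => by positivity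
  have hgrad : eWeakGradL2Sq m ≤ ENNReal.ofReal (∫ x, ‖curl m x‖ ^ 2) :=
    (eWeakGradL2Sq_eq_ofReal_enstrophy hsm hdiv h0 h1 h2).le
  exact hloc hν hT (memLp_two_of_admissible hsm h0) (isWeaklyDivFree_of_admissible hsm hdiv) hA hgrad hT'

/-! ## §3 Window form: a uniform fraction of the would-be blow-up window -/

/-- **Reference flow on a uniform fraction of the window.** For every `c > 0` there is `η₀ ∈ (0,1)`, uniform in the
viscosity and in the field, such that every admissible `m` with `0 < Z(m) = ∫ ‖curl m‖²` has, for every `ν > 0`, a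
reference flow (as in `exists_referenceFlow`) on `[0, T]` with `T = η₀ · (64ν³/(27c⁴)) · Z(m)⁻²` — the fraction `η₀` of the
would-be blow-up time of the cubic law with constant `c`. (`η₀ = min (1/2) (27 c⁴ c_L / 64)`.)
[cite: OzanskiPooley2018, Thm. 6.30, Cor. 6.16, Lemma 6.29] -/
theorem exists_referenceFlow_window (c : ℝ) (hc : 0 < c) :
    ∃ η₀ : ℝ, 0 < η₀ ∧ η₀ < 1 ∧ ∀ ν : ℝ, 0 < ν →
      ∀ m : EuclideanSpace ℝ (Fin 3) → EuclideanSpace ℝ (Fin 3),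
        (ContDiff ℝ (⊤ : ℕ∞) m ∧ VectorCalculus.IsDivFree m ∧ (∫⁻ x, ‖iteratedFDeriv ℝ 0 m x‖ₑ ^ 2 < ⊤) ∧
          (∫⁻ x, ‖iteratedFDeriv ℝ 1 m x‖ₑ ^ 2 < ⊤) ∧ (∫⁻ x, ‖iteratedFDeriv ℝ 2 m x‖ₑ ^ 2 < ⊤)) →
        0 < (∫ x, ‖curl m x‖ ^ 2) →
        ∃ (v : ℝ → EuclideanSpace ℝ (Fin 3) → EuclideanSpace ℝ (Fin 3)) (q : ℝ → EuclideanSpace ℝ (Fin 3) → ℝ),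
          IsLerayHopfOn (η₀ * (64 * ν ^ 3 / (27 * c ^ 4) * (∫ x, ‖curl m x‖ ^ 2)⁻¹ ^ 2)) ν 0 m v ∧ v 0 = m ∧
          IsH1RegularOn (Icc 0 (η₀ * (64 * ν ^ 3 / (27 * c ^ 4) * (∫ x, ‖curl m x‖ ^ 2)⁻¹ ^ 2))) v ∧
          IsClassicalNSSolutionOn (Ioc 0 (η₀ * (64 * ν ^ 3 / (27 * c ^ 4) * (∫ x, ‖curl m x‖ ^ 2)⁻¹ ^ 2))) ν 0 v q ∧
          ∀ δ : ℝ, 0 < δ → δ ≤ η₀ * (64 * ν ^ 3 / (27 * c ^ 4) * (∫ x, ‖curl m x‖ ^ 2)⁻¹ ^ 2) →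
            HasBoundedSobolevNormsOn (Icc δ (η₀ * (64 * ν ^ 3 / (27 * c ^ 4) * (∫ x, ‖curl m x‖ ^ 2)⁻¹ ^ 2))) v ∧
            HasBoundedSobolevNormsOn (Icc δ (η₀ * (64 * ν ^ 3 / (27 * c ^ 4) * (∫ x, ‖curl m x‖ ^ 2)⁻¹ ^ 2)))
              (timeDerivWithin (Ioc 0 (η₀ * (64 * ν ^ 3 / (27 * c ^ 4) * (∫ x, ‖curl m x‖ ^ 2)⁻¹ ^ 2))) v) ∧
            (∀ n : ℕ, ∃ C : ℝ, ∀ t ∈ Icc δ (η₀ * (64 * ν ^ 3 / (27 * c ^ 4) * (∫ x, ‖curl m x‖ ^ 2)⁻¹ ^ 2)), ∀ x,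
              ‖iteratedFDeriv ℝ n (v t) x‖ ≤ C) ∧
            (∀ n : ℕ, ∃ C : ℝ≥0, ∀ t ∈ Icc δ (η₀ * (64 * ν ^ 3 / (27 * c ^ 4) * (∫ x, ‖curl m x‖ ^ 2)⁻¹ ^ 2)),
              ∫⁻ x, ‖iteratedFDeriv ℝ n (q t) x‖ₑ ^ 2 ≤ C) := by
  obtain ⟨cL, hcL, href⟩ := exists_referenceFlow
  refine ⟨min (1 / 2) (27 * c ^ 4 * cL / 64), lt_min (by norm_num) (by positivity),
    (min_le_left _ _).trans_lt (by norm_num), fun ν hν m hm hZ => ?_⟩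
  set η₀ : ℝ := min (1 / 2) (27 * c ^ 4 * cL / 64) with hη₀
  set Z : ℝ := ∫ x, ‖curl m x‖ ^ 2 with hZdef
  have hη₀pos : 0 < η₀ := lt_min (by norm_num) (by positivity)
  have hT : 0 < η₀ * (64 * ν ^ 3 / (27 * c ^ 4) * Z⁻¹ ^ 2) := by positivity
  refine href ν _ hν hT m hm ?_
  -- `Z² · (η₀ · (64ν³/(27c⁴)) · Z⁻²) = η₀ · 64ν³/(27c⁴) ≤ c_L ν³`
  have hZ2 : Z ^ 2 * (η₀ * (64 * ν ^ 3 / (27 * c ^ 4) * Z⁻¹ ^ 2)) = η₀ * (64 * ν ^ 3 / (27 * c ^ 4)) := by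
    field_simp
  rw [hZ2]
  have hle : η₀ ≤ 27 * c ^ 4 * cL / 64 := min_le_right _ _
  have h27 : 0 < 64 * ν ^ 3 / (27 * c ^ 4) := by positivity
  calc η₀ * (64 * ν ^ 3 / (27 * c ^ 4)) ≤ 27 * c ^ 4 * cL / 64 * (64 * ν ^ 3 / (27 * c ^ 4)) :=
        mul_le_mul_of_nonneg_right hle h27.le
    _ = cL * ν ^ 3 := by field_simp

/-! ## §4 The reference flow in its class: the interior enstrophy budget -/

section Budget

variable {ν T : ℝ} {v : ℝ → EuclideanSpace ℝ (Fin 3) → EuclideanSpace ℝ (Fin 3)}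
  {q : ℝ → EuclideanSpace ℝ (Fin 3) → ℝ}

/-- **Time shift into the Chae/BKM class.** If `(v,q)` is classical on `(0,T]` with all Sobolev norms of `v` bounded on
every `[δ,T]`, then for `0 < δ < T` the shifted pair `s ↦ (v (s+δ), q (s+δ))` is a classical solution on `[0, T−δ)` from
`v δ` with all Sobolev norms bounded on every closed sub-slab (`Chae2007.IsLocalSolution`). [folklore] -/
theorem isLocalSolution_shift (hcl : IsClassicalNSSolutionOn (Ioc 0 T) ν 0 v q)
    (hB : ∀ δ : ℝ, 0 < δ → δ ≤ T → HasBoundedSobolevNormsOn (Icc δ T) v) {δ : ℝ} (hδ : 0 < δ) (hδT : δ < T) :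
    IsLocalSolution ν (T - δ) (v δ) (fun s => v (s + δ)) (fun s => q (s + δ)) where
  isClassical := by
    have h := hcl.comp_add_right δ
    refine h.mono (fun s hs => ?_) (uniqueDiffOn_Ico 0 (T - δ))
    simp only [mem_preimage, mem_Ioc]
    exact ⟨by linarith [hs.1], by linarith [hs.2]⟩
  initial := by simp only [zero_add]
  sobolev := fun T'' hT'' =>
    HasBoundedSobolevNormsOn.comp_add_right δ
      ((hB δ hδ hδT.le).mono (Icc_subset_Icc (by linarith) (by linarith)))

/-- **The interior enstrophy identity along the reference flow**: at every `t ∈ (0,T)`,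
`d/dt ∫|curl v|² = 2∫⟪ω,(∇v)ω⟫ − 2ν∫|∇ω|²_F` (Majda–Bertozzi §3.1.1, through the landed
`LucardoOlivaes2026.hasDerivAt_half_ensq` after a time shift). [cite: MajdaBertozziCUP2002, §3.1.1 p. 87–88] -/
theorem hasDerivAt_enstrophy (hν : 0 < ν) (hcl : IsClassicalNSSolutionOn (Ioc 0 T) ν 0 v q)
    (hB : ∀ δ : ℝ, 0 < δ → δ ≤ T → HasBoundedSobolevNormsOn (Icc δ T) v) {t : ℝ} (ht : t ∈ Ioo 0 T) :
    HasDerivAt (fun s => ∫ x, ‖curl (v s) x‖ ^ 2)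
      (2 * (∫ x, ⟪curl (v t) x, fderiv ℝ (v t) x (curl (v t) x)⟫_ℝ) -
        2 * ν * (∫ x, frobeniusNormSq (fderiv ℝ (curl (v t)) x))) t := by
  have hδ : 0 < t / 2 := by linarith [ht.1]
  have hδT : t / 2 < T := by linarith [ht.1, ht.2]
  have hLS := isLocalSolution_shift hcl hB hδ hδT
  have ht' : t - t / 2 ∈ Ioo 0 (T - t / 2) := ⟨by linarith [ht.1], by linarith [ht.2]⟩
  have hD := ((hasDerivAt_half_ensq hν hLS ht').const_mul 2).comp_sub_const t (t / 2)
  have hfun : (fun s => 2 * ((1 / 2 : ℝ) * ensq (fun s' => v (s' + t / 2)) (s - t / 2))) =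
      fun s => ∫ x, ‖curl (v s) x‖ ^ 2 := by
    funext s
    simp only [ensq, sub_add_cancel]
    ring
  rw [hfun] at hD
  refine hD.congr_deriv ?_
  simp only [stretchI, sub_add_cancel]
  ring

/-- The slices of the reference flow at positive times are ADMISSIBLE: `C^∞`, divergence free, with all Sobolev
seminorms finite (in particular `D⁰, D¹, D² ∈ L²`). [folklore] -/
theorem slice_admissible (hcl : IsClassicalNSSolutionOn (Ioc 0 T) ν 0 v q)
    (hB : ∀ δ : ℝ, 0 < δ → δ ≤ T → HasBoundedSobolevNormsOn (Icc δ T) v) {t : ℝ} (ht : t ∈ Ioc 0 T) :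
    ContDiff ℝ (⊤ : ℕ∞) (v t) ∧ VectorCalculus.IsDivFree (v t) ∧ (∫⁻ x, ‖iteratedFDeriv ℝ 0 (v t) x‖ₑ ^ 2 < ⊤) ∧
      (∫⁻ x, ‖iteratedFDeriv ℝ 1 (v t) x‖ₑ ^ 2 < ⊤) ∧ (∫⁻ x, ‖iteratedFDeriv ℝ 2 (v t) x‖ₑ ^ 2 < ⊤) := by
  have hfin : ∀ n : ℕ, ∫⁻ x, ‖iteratedFDeriv ℝ n (v t) x‖ₑ ^ 2 < ⊤ := fun n => by
    obtain ⟨C, hC⟩ := hB t ht.1 ht.2 n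
    exact (hC t ⟨le_rfl, ht.2⟩).trans_lt ENNReal.coe_lt_top
  exact ⟨hcl.contDiff_velocity ht, hcl.divFree t ht, hfin 0, hfin 1, hfin 2⟩

/-- **The enstrophy budget of the reference flow in its class.** Along `(v,q)` classical on `(0,T]` with all Sobolev
norms of `v` bounded on every `[δ,T]`, at every interior time `t ∈ (0,T)`: the real enstrophy `Z(s) = ∫|curl v(s)|²`
has derivative `2S − 2ν·Pal` at `t`, and for every one-sided admissible Lu–Doering constant `c`
(`∫⟪ω,(∇w)ω⟫ ≤ c Z^{3/4} Pal^{3/4}` on admissible fields) the cubic law `2S − 2ν·Pal ≤ (27c⁴/(128ν³))·Z(t)³` holds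
(Young's inequality, `LuDoeringRung.young_envelope`). [cite: LuDoering2008, eq. (6)] -/
theorem budget (hν : 0 < ν) (hcl : IsClassicalNSSolutionOn (Ioc 0 T) ν 0 v q)
    (hB : ∀ δ : ℝ, 0 < δ → δ ≤ T → HasBoundedSobolevNormsOn (Icc δ T) v) {c : ℝ}
    (hc : ∀ w : EuclideanSpace ℝ (Fin 3) → EuclideanSpace ℝ (Fin 3), (ContDiff ℝ (⊤ : ℕ∞) w ∧
      VectorCalculus.IsDivFree w ∧ (∫⁻ x, ‖iteratedFDeriv ℝ 0 w x‖ₑ ^ 2 < ⊤) ∧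
      (∫⁻ x, ‖iteratedFDeriv ℝ 1 w x‖ₑ ^ 2 < ⊤) ∧ (∫⁻ x, ‖iteratedFDeriv ℝ 2 w x‖ₑ ^ 2 < ⊤)) →
      (∫ x, ⟪curl w x, fderiv ℝ w x (curl w x)⟫_ℝ) ≤ c * (∫ x, ‖curl w x‖ ^ 2) ^ (3 / 4 : ℝ) *
        (∫ x, frobeniusNormSq (fderiv ℝ (curl w) x)) ^ (3 / 4 : ℝ))
    {t : ℝ} (ht : t ∈ Ioo 0 T) :
    HasDerivAt (fun s => ∫ x, ‖curl (v s) x‖ ^ 2)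
        (2 * (∫ x, ⟪curl (v t) x, fderiv ℝ (v t) x (curl (v t) x)⟫_ℝ) -
          2 * ν * (∫ x, frobeniusNormSq (fderiv ℝ (curl (v t)) x))) t ∧
      2 * (∫ x, ⟪curl (v t) x, fderiv ℝ (v t) x (curl (v t) x)⟫_ℝ) -
          2 * ν * (∫ x, frobeniusNormSq (fderiv ℝ (curl (v t)) x)) ≤
        27 * c ^ 4 / (128 * ν ^ 3) * (∫ x, ‖curl (v t) x‖ ^ 2) ^ 3 := by
  refine ⟨hasDerivAt_enstrophy hν hcl hB ht, ?_⟩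
  have hadm := slice_admissible hcl hB ⟨ht.1, ht.2.le⟩
  have hZ : 0 ≤ ∫ x, ‖curl (v t) x‖ ^ 2 := integral_nonneg fun x => by positivity
  have hP : 0 ≤ ∫ x, frobeniusNormSq (fderiv ℝ (curl (v t)) x) := integral_nonneg fun x => frobeniusNormSq_nonneg _
  have hS := hc (v t) hadm
  calc 2 * (∫ x, ⟪curl (v t) x, fderiv ℝ (v t) x (curl (v t) x)⟫_ℝ) -
          2 * ν * (∫ x, frobeniusNormSq (fderiv ℝ (curl (v t)) x))
        ≤ 2 * (c * (∫ x, ‖curl (v t) x‖ ^ 2) ^ (3 / 4 : ℝ) *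
            (∫ x, frobeniusNormSq (fderiv ℝ (curl (v t)) x)) ^ (3 / 4 : ℝ)) -
          2 * ν * (∫ x, frobeniusNormSq (fderiv ℝ (curl (v t)) x)) := by linarith
    _ ≤ 27 * c ^ 4 / (128 * ν ^ 3) * (∫ x, ‖curl (v t) x‖ ^ 2) ^ 3 := young_envelope hν hZ hP

/-- **Rung zero along the reference flow (integrated cubic law).** Under the hypotheses of `budget`, if the enstrophy is
positive on `[s, t] ⊆ (0,T)` then `Z(s)⁻² − Z(t)⁻² ≤ (27c⁴/(64ν³))·(t − s)` — the would-be blow-up window of the cubic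
law started at `s` has length at least `(64ν³/(27c⁴))·Z(s)⁻²`. [cite: LuDoering2008, eq. (6)] -/
theorem inv_sq_sub_inv_sq_le (hν : 0 < ν) (hcl : IsClassicalNSSolutionOn (Ioc 0 T) ν 0 v q)
    (hB : ∀ δ : ℝ, 0 < δ → δ ≤ T → HasBoundedSobolevNormsOn (Icc δ T) v) {c : ℝ}
    (hc : ∀ w : EuclideanSpace ℝ (Fin 3) → EuclideanSpace ℝ (Fin 3), (ContDiff ℝ (⊤ : ℕ∞) w ∧
      VectorCalculus.IsDivFree w ∧ (∫⁻ x, ‖iteratedFDeriv ℝ 0 w x‖ₑ ^ 2 < ⊤) ∧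
      (∫⁻ x, ‖iteratedFDeriv ℝ 1 w x‖ₑ ^ 2 < ⊤) ∧ (∫⁻ x, ‖iteratedFDeriv ℝ 2 w x‖ₑ ^ 2 < ⊤)) →
      (∫ x, ⟪curl w x, fderiv ℝ w x (curl w x)⟫_ℝ) ≤ c * (∫ x, ‖curl w x‖ ^ 2) ^ (3 / 4 : ℝ) *
        (∫ x, frobeniusNormSq (fderiv ℝ (curl w) x)) ^ (3 / 4 : ℝ))
    {t₁ : ℝ} (ht₁ : 0 < t₁) (hpos : ∀ τ ∈ Ico t₁ T, 0 < ∫ x, ‖curl (v τ) x‖ ^ 2)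
    {s t : ℝ} (hs : t₁ ≤ s) (hst : s ≤ t) (htT : t < T) :
    (∫ x, ‖curl (v s) x‖ ^ 2)⁻¹ ^ 2 - (∫ x, ‖curl (v t) x‖ ^ 2)⁻¹ ^ 2 ≤
      2 * (27 * c ^ 4 / (128 * ν ^ 3)) * (t - s) := by
  have hder : ∀ τ ∈ Ico t₁ T, ∃ D : ℝ, HasDerivAt (fun s => ∫ x, ‖curl (v s) x‖ ^ 2) D τ ∧
      D ≤ 27 * c ^ 4 / (128 * ν ^ 3) * (∫ x, ‖curl (v τ) x‖ ^ 2) ^ 3 := fun τ hτ =>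
    ⟨_, (budget hν hcl hB hc ⟨ht₁.trans_le hτ.1, hτ.2⟩).1, (budget hν hcl hB hc ⟨ht₁.trans_le hτ.1, hτ.2⟩).2⟩
  exact ProductionEfficiencyDecay.stub_integrateEfficiency (fun s => ∫ x, ‖curl (v s) x‖ ^ 2) t₁ T
    (27 * c ^ 4 / (128 * ν ^ 3)) hpos hder s t hs hst htT

end Budget

end ReferenceFlow

end RigidExit

end Summit.NavierStokesRegularity.NavierStokesRegularity.Theorems

end
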